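import Summits.CriticalPhenomena.PercolationContinuityZ3.Theorems.PercNearOneGluingNoHeavyLowerTailSwitchRelaxTables
import HarnessLib

/-!
# `NoHeavyLowerTail` (stmt-CriticalPhenomena-4575) — the FINITE RELAXATION of three-copy switching certificates, IId:
# the SCALABLE kernel checker (tabulated transfer rules, Nat-coded signatures, coverage + pair checks) and its soundness

Support file (prover prim-cert-2 gen 12; `--supports stmt-CriticalPhenomena-4575`).  No named facts, no sorries.

The check of part II (`Cert.check`: enumerate abstract state pairs, maximise the potentials) is sound but its kernel
evaluation does not scale past prim-l12-p1's `GR3` (kernel MEMORY: every reduction step is cached; a declaration dies after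
≈ 10⁷ steps).  This file re-implements the same relaxation for the kernel's cost model:

* types are handled as indices `k < 15` with join matrices `jt k` (part IIc), so the transfer rules cost O(10) bit operations;
* everything that depends on one or two types only is TABULATED over the literal index list `idxs` (closed terms, so the
  kernel's structural cache shares them across states): candidate avoidance types `candsN`, clean / messy admissible-output
  lists `cleanTabN` / `messyTabN` (already reduced to ROW resp. COLUMN representatives of the potential tables, `rowRepN` /
  `colRepN`), potentials as nested lists `tab2N`;
* a per-copy SIGNATURE (representative of the own type + per-program admissible-output sets) is CODED as one natural number
  (`codeY` / `codeZ`: 4 bits + 15 bits per program); the deduplicated code lists `LY`, `LZ` are supplied by the certificate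
  file as literal data (computed offline), and the kernel checks COVERAGE (`Cert.coverN`: the code of every generated state
  is listed) and the PAIR condition (`pairCheckN`: `λ₀ + Σ_p max λ_p ≤ 0` for every listed code pair, digits canonicalised by
  `withVal` so that the per-program maxima `bestM` are shared across pairs); both are plain conjunctions, so certificate files
  split them into as many kernel-sized declarations as needed.

Soundness is in `…SwitchRelaxCheckNSound` (`Cert.soundN`); the vectorised form of the pair check in `…SwitchRelaxCheckV`.
-/

namespace Summit.CriticalPhenomena.PercolationContinuityZ3.Theorems

namespace SwitchRelax

open Finset Literature.Probability.Percolation Literature.Probability.Percolation.DecisionTree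
open Literature.Probability.Percolation.Gladkov ThreePointLB GroupThreePointLB FourPointAtoms

/-! ### Tabulated admissible outputs -/

/-- Representatives of the admissible CLEAN outputs, by avoidance-type index. [this work] -/
def cleanOutsN (jX w : ℕ) (rep : ℕ → ℕ) (pk : ℕ) : List ℕ :=
  (idxs.filter fun qk => admCleanN jX w (jt pk) (jt qk)).map rep
/-- Its table over the avoidance-type index. [this work] -/
def cleanTabN (jX w : ℕ) (rep : ℕ → ℕ) : List (List ℕ) := idxs.map (cleanOutsN jX w rep)
/-- Representatives of the admissible MESSY outputs, by (own type, avoidance type of the second root). [this work] -/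
def messyOutsN (jX w v : ℕ) (rep : ℕ → ℕ) (tk pk : ℕ) : List ℕ :=
  (idxs.filter fun qk => admMessyN jX w v (jt tk) (jt pk) (jt qk)).map rep
/-- Its table. [this work] -/
def messyTabN (jX w v : ℕ) (rep : ℕ → ℕ) : List (List (List ℕ)) :=
  idxs.map fun tk => idxs.map (messyOutsN jX w v rep tk)

/-- Admissible-output representatives of copy `Y` under program `p` with potential table `T`, for the state `(tk, ps)`. [this work] -/
def outsY (πX : Ty) (p : Prog) (T : List (List ℤ)) (tk : ℕ) (ps : List ℕ) : List ℕ :=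
  match p.kind with
  | 0 => getN (cleanTabN (J πX) (wmask πX p.U) (rowRepN T)) (getN ps p.iU 0) []
  | 1 => [rowRepN T tk]
  | 2 => getN (cleanTabN (J πX) (wmask πX p.U) (rowRepN T)) (getN ps p.iU 0) []
  | 3 => getN (getN (messyTabN (J πX) (wmask πX p.U) p.v.val (rowRepN T)) tk []) (getN ps p.iV 0) []

/-- Admissible-output representatives of copy `Z`. [this work] -/
def outsZ (πX : Ty) (p : Prog) (T : List (List ℤ)) (tk : ℕ) (ps : List ℕ) : List ℕ :=
  match p.kind with
  | 0 => [colRepN T tk]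
  | 1 => getN (cleanTabN (J πX) (wmask πX p.U) (colRepN T)) (getN ps p.iU 0) []
  | 2 => getN (getN (messyTabN (J πX) (wmask πX p.U) p.v.val (colRepN T)) tk []) (getN ps p.iV 0) []
  | 3 => getN (cleanTabN (J πX) (wmask πX p.U) (colRepN T)) (getN ps p.iU 0) []

/-- The `Y`-lists of all programs (aligned with the table list). [this work] -/
def outsYL (πX : Ty) (tk : ℕ) (ps : List ℕ) : List Prog → List (List (List ℤ)) → List (List ℕ)
  | p :: qs, T :: Ts => outsY πX p T tk ps :: outsYL πX tk ps qs Ts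
  | _, _ => []
/-- The `Z`-lists of all programs. [this work] -/
def outsZL (πX : Ty) (tk : ℕ) (ps : List ℕ) : List Prog → List (List (List ℤ)) → List (List ℕ)
  | p :: qs, T :: Ts => outsZ πX p T tk ps :: outsZL πX tk ps qs Ts
  | _, _ => []

/-! ### Signature codes -/

/-- `2^64`. [folklore] -/
def W64 : ℕ := 18446744073709551616
/-- **Fingerprint mixing.**  The kernel hashes a big numeral by its low machine word; raw signature codes share their low
bits, which makes the kernel's expression caches degenerate (measured: ×100 slow-down).  `mix c` appends the residue of
`c` modulo the prime `2^64 − 59` as the low word; `unmix` recovers `c`. [this work] -/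
def mix (c : ℕ) : ℕ := c * W64 + c % 18446744073709551557
/-- Inverse of `mix`. [this work] -/
def unmix (a : ℕ) : ℕ := a / W64
/-- `unmix ∘ mix = id`. [this work] -/
theorem unmix_mix (c : ℕ) : unmix (mix c) = c := by
  rw [unmix, mix, W64, mul_comm, Nat.mul_add_div (by norm_num), Nat.div_eq_of_lt, add_zero]
  exact lt_trans (Nat.mod_lt _ (by norm_num)) (by norm_num)

/-- **Signature code of a state in the role of copy `Y`**: row representative of its type + coded output lists, mixed. [this work] -/
def codeY (c : Cert) (πX : Ty) (T0 : List (List ℤ)) (TP : List (List (List ℤ))) (s : ℕ × List ℕ) : ℕ :=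
  match s with
  | (tk, ps) => mix (rowRepN T0 tk + 16 * encOuts (outsYL πX tk ps c.progs TP))
/-- **Signature code of a state in the role of copy `Z`.** [this work] -/
def codeZ (c : Cert) (πX : Ty) (T0 : List (List ℤ)) (TP : List (List (List ℤ))) (s : ℕ × List ℕ) : ℕ :=
  match s with
  | (tk, ps) => mix (colRepN T0 tk + 16 * encOuts (outsZL πX tk ps c.progs TP))

/-! ### States -/

/-- Candidate avoidance-type indices for root set `U` given the own-type index `tk`. [this work] -/
def candsN (πX : Ty) (tk : ℕ) (U : Finset (Fin 4)) : List ℕ :=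
  idxs.filter fun pk => refinesN (jt pk) (jt tk) && rootOKN (J πX) (wmask πX U) (jt pk)

/-- Monotonicity against the already fixed avoidance types. [this work] -/
def pairOKN (πX : Ty) (U : Finset (Fin 4)) (pk : ℕ) : List (Finset (Fin 4)) → List ℕ → Bool
  | U' :: RS', pk' :: ps' =>
    (!maskLE πX U U' || refinesN (jt pk') (jt pk)) && (!maskLE πX U' U || refinesN (jt pk) (jt pk')) &&
      pairOKN πX U pk RS' ps'
  | _, _ => true

/-- Generate the avoidance-type tuples. [this work] -/
def genN (πX : Ty) (tk : ℕ) : List (Finset (Fin 4)) → List ℕ → List (Finset (Fin 4)) → List (List ℕ)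
  | _, _, [] => [[]]
  | RSd, psd, U :: rest =>
    (candsN πX tk U).flatMap fun pk =>
      if pairOKN πX U pk RSd psd then (genN πX tk (RSd ++ [U]) (psd ++ [pk]) rest).map (fun l => pk :: l) else []

/-- Validity of a tuple, in the shape of the generator. [this work] -/
def validN (πX : Ty) (tk : ℕ) : List (Finset (Fin 4)) → List ℕ → List (Finset (Fin 4)) → List ℕ → Prop
  | _, _, [], ps => ps = []
  | RSd, psd, U :: rest, ps => ∃ pk ps', ps = pk :: ps' ∧ pk ∈ candsN πX tk U ∧ pairOKN πX U pk RSd psd = true ∧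
      validN πX tk (RSd ++ [U]) (psd ++ [pk]) rest ps'

/-- **Completeness of the generator.** [this work] -/
theorem genN_complete (πX : Ty) (tk : ℕ) :
    ∀ (rest RSd : List (Finset (Fin 4))) (psd ps : List ℕ), validN πX tk RSd psd rest ps → ps ∈ genN πX tk RSd psd rest
  | [], RSd, psd, ps, h => by simp only [validN] at h; subst h; simp [genN]
  | U :: rest, RSd, psd, ps, h => by
    obtain ⟨pk, ps', rfl, hc, hp, hv⟩ := h
    simp only [genN, List.mem_flatMap]
    refine ⟨pk, hc, ?_⟩
    rw [if_pos hp, List.mem_map]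
    exact ⟨ps', genN_complete πX tk rest _ _ ps' hv, rfl⟩

/-- The states for the input type `πX` whose own-type index lies in `tks`. [this work] -/
def Cert.statesNtk (c : Cert) (πX : Ty) (tks : List ℕ) : List (ℕ × List ℕ) :=
  tks.flatMap fun tk => (genN πX tk [] [] c.RS).map fun ps => (tk, ps)

/-- All states for the input type `πX`. [this work] -/
def Cert.statesN (c : Cert) (πX : Ty) : List (ℕ × List ℕ) := c.statesNtk πX idxs

/-! ### The checks -/

/-- Coverage of the states with own-type index in `tks` (certificate files may check own types separately). [this work] -/
def Cert.coverNtk (c : Cert) (πX : Ty) (tks : List ℕ) (T0 : List (List ℤ)) (TP : List (List (List ℤ)))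
    (LY LZ : List ℕ) : Bool :=
  (c.statesNtk πX tks).all fun s => elemN (codeY c πX T0 TP s) LY && elemN (codeZ c πX T0 TP s) LZ

/-- **COVERAGE**: the codes of every generated state are listed. [this work] -/
def Cert.coverN (c : Cert) (πX : Ty) (T0 : List (List ℤ)) (TP : List (List (List ℤ))) (LY LZ : List ℕ) : Bool :=
  c.coverNtk πX idxs T0 TP LY LZ

/-- Coverage over a concatenation of own-type ranges. [this work] -/
theorem Cert.coverNtk_append (c : Cert) (πX : Ty) {tks₁ tks₂ : List ℕ} {T0 : List (List ℤ)} {TP : List (List (List ℤ))}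
    {LY LZ : List ℕ} (h₁ : c.coverNtk πX tks₁ T0 TP LY LZ = true) (h₂ : c.coverNtk πX tks₂ T0 TP LY LZ = true) :
    c.coverNtk πX (tks₁ ++ tks₂) T0 TP LY LZ = true := by
  simp only [Cert.coverNtk, Cert.statesNtk, List.flatMap_append, List.all_append, Bool.and_eq_true] at h₁ h₂ ⊢
  exact ⟨h₁, h₂⟩

/-- Coverage from coverage of own-type ranges that concatenate to all indices (the equation is `by decide` in
certificate files; stated this way so that no definitional unfolding of the check is ever asked of the elaborator). [this work] -/
theorem Cert.coverN_of_split (c : Cert) (πX : Ty) {tks₁ tks₂ : List ℕ} (h : tks₁ ++ tks₂ = idxs) {T0 : List (List ℤ)}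
    {TP : List (List (List ℤ))} {LY LZ : List ℕ} (h₁ : c.coverNtk πX tks₁ T0 TP LY LZ = true)
    (h₂ : c.coverNtk πX tks₂ T0 TP LY LZ = true) : c.coverN πX T0 TP LY LZ = true := by
  rw [Cert.coverN, ← h]; exact c.coverNtk_append πX h₁ h₂

/-- Maximum of a table over a product of masks (`bot` if empty). [this work] -/
def bestM (T : List (List ℤ)) (ma mb : ℕ) : ℤ :=
  ((bitsOf ma).flatMap fun q => (bitsOf mb).map fun q' => get2 T q q').foldr max bot
/-- `Σ_p max λ_p` along the coded output lists. [this work] -/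
def sumBestM : List (List (List ℤ)) → ℕ → ℕ → ℤ
  | T :: Ts, ca, cb =>
    withVal (ca % 32768) (fun ma => withVal (cb % 32768) fun mb => bestM T ma mb) + sumBestM Ts (ca / 32768) (cb / 32768)
  | [], _, _ => 0
/-- Value of an (unmixed) code pair: `λ₀(rep t_Y, rep t_Z) + Σ_p max λ_p`. [this work] -/
def valCore (T0 : List (List ℤ)) (TP : List (List (List ℤ))) (a b : ℕ) : ℤ :=
  withVal (a % 16) (fun ta => withVal (b % 16) fun tb => get2 T0 ta tb) + sumBestM TP (a / 16) (b / 16)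
/-- Value of a (mixed) code pair. [this work] -/
def valM (T0 : List (List ℤ)) (TP : List (List (List ℤ))) (a b : ℕ) : ℤ := valCore T0 TP (unmix a) (unmix b)
/-- **PAIR CHECK**: every listed code pair has value `≤ 0`. [this work] -/
def pairCheckN (T0 : List (List ℤ)) (TP : List (List (List ℤ))) (LY LZ : List ℕ) : Bool :=
  LY.all fun a => LZ.all fun b => decide (valM T0 TP a b ≤ 0)

/-- The pair condition as a proposition (established by `pairCheckN` here, or by the vectorised check of part IIe). [this work] -/
def PairOK (T0 : List (List ℤ)) (TP : List (List (List ℤ))) (LY LZ : List ℕ) : Prop :=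
  ∀ a ∈ LY, ∀ b ∈ LZ, valM T0 TP a b ≤ 0

/-- The direct pair check establishes the pair condition. [this work] -/
theorem pairOK_of_pairCheckN {T0 : List (List ℤ)} {TP : List (List (List ℤ))} {LY LZ : List ℕ}
    (h : pairCheckN T0 TP LY LZ = true) : PairOK T0 TP LY LZ := by
  simpa [pairCheckN, PairOK, List.all_eq_true] using h

/-- Splitting the pair check along the `Y`-list (certificate files check the chunks separately). [this work] -/
theorem pairCheckN_append {T0 : List (List ℤ)} {TP : List (List (List ℤ))} {L1 L2 LZ : List ℕ}
    (h1 : pairCheckN T0 TP L1 LZ = true) (h2 : pairCheckN T0 TP L2 LZ = true) : pairCheckN T0 TP (L1 ++ L2) LZ = true := by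
  simp only [pairCheckN, List.all_append, Bool.and_eq_true]; exact ⟨h1, h2⟩

/-- Splitting the coverage check into two state ranges is not needed; but covering lists may be concatenations: monotonicity
of coverage in the lists. [this work] -/
theorem elemN_append_left {a : ℕ} : ∀ {L1 : List ℕ} (L2 : List ℕ), elemN a L1 = true → elemN a (L1 ++ L2) = true
  | [], _, h => by simp [elemN] at h
  | b :: l, L2, h => by
    simp only [List.cons_append, elemN, Bool.or_eq_true] at h ⊢
    rcases h with h | h
    · exact Or.inl h
    · exact Or.inr (elemN_append_left L2 h)

/-- `bestM` bounds every table value at members of the masks. [this work] -/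
theorem get2_le_bestM (T : List (List ℤ)) {ly lz : List ℕ} (hly : ∀ q ∈ ly, q < 15) (hlz : ∀ q ∈ lz, q < 15)
    {q q' : ℕ} (hq : q ∈ ly) (hq' : q' ∈ lz) : get2 T q q' ≤ bestM T (maskOf ly) (maskOf lz) :=
  le_foldr_max bot (List.mem_flatMap.2 ⟨q, mem_bitsOf (hly q hq) (testBit_maskOf.2 hq),
    List.mem_map.2 ⟨q', mem_bitsOf (hlz q' hq') (testBit_maskOf.2 hq'), rfl⟩⟩)

end SwitchRelax

end Summit.CriticalPhenomena.PercolationContinuityZ3.Theorems
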